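import Literature.Computability.Cryptography.CubicClassSamplingSpecs
import Literature.Computability.Cryptography.CubicClassPostDual
import Literature.Computability.Cryptography.CubicClassPostRecover
import HarnessLib

/-!
# The class-group stage: labels of accurate Fourier-sampling outcomes and exact recovery of the paired character

Topic `Computability/Cryptography`; companion of `CubicClassSamplingSpecs.lean` (the per-unit law `UnitSamplingLaw`, accurate
outcomes `Acc`, `AccAll`, characters `dualReps`), `CubicClassPostDual.lean` (the dual group as the annihilator `annih h Λ`) and
`CubicClassPostRecover.lean` (exact recovery); consumer: the proof of `CubicClassSampling.ClaimPost` (crux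
`LinnikCubicClassGroups.PureCubicClassGroupFBQP`, line `arakelov-giant-step-cycle`). Real definitions and theorems; no named facts.

An accurate outcome `c` (`c ∈ AccAll`) decodes (`dec`, residue label `klab`) and is accurate for exactly ONE character
`xiOf c ∈ dualReps` (`eq_of_mem_Acc`: distinct representatives are `1/h`-separated modulo `1` in some coordinate while `2δ < 1/h`),
whose residue vector is its **group label** `glab c ∈ annih h Λ`; the sets of the near-uniformity clause of `UnitSamplingLaw` are
the label fibres (`mem_Acc_repQ_iff`, `exists_mem_Acc_iff`). For a pair the post-processor's reduced coefficients depend on the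
residues only (`cf`, `coefs_eq_cf`), the combined group element is `sG c c' = c₁ • glab c + c₂ • glab c'`, and on an accurate
pair **`exists_deriveR_eq_repQ_sG`**: `deriveR (dec c) (dec c') t = repQ (sG c c') t + (integer)`. `pairEvSet H` is the event
"both accurate and `sG ∈ H`". [Hallgren 2005, §4; Kitaev 1995, §4]

## References

* S. Hallgren, STOC 2005, §4. [Hallgren2005]
* A. Yu. Kitaev, arXiv:quant-ph/9511026 (1995), §4. [Kitaev1995]
-/

noncomputable section

open scoped Classical

namespace Literature.Computability.Cryptography

namespace CubicClassSampling

open CubicClassPost Finset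

/-! ### Labels of accurate outcomes -/

variable (P : PostParams) (Λ : AddSubgroup (Fin P.T → ℤ)) (μ' : Fin P.T → ℝ) (δ : ℝ)

/-- The decoded unit of an outcome (junk `(0,0)` when it does not decode). [folklore] -/
def dec (c : ℕ) : ℤ × ℕ := (P.decodeUnit c).getD (0, 0)

/-- The residue label `kk` of an outcome. [folklore] -/
def klab (c : ℕ) : ℤ := (dec P c).1

/-- The character (representative in `[0,1)^T`) of an accurate outcome (junk `0` otherwise). [folklore] -/
def xiOf (c : ℕ) : Fin P.T → ℚ :=
  if hc : c ∈ AccAll P Λ μ' δ then Classical.choose (Classical.choose_spec hc) else 0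

variable {P Λ μ' δ}

/-- A decoding outcome's `dec` is the decoded unit. [folklore] -/
theorem dec_eq_of_decodeUnit {c : ℕ} {u : ℤ × ℕ} (hu : P.decodeUnit c = some u) : dec P c = u := by
  rw [dec, hu]; rfl

/-- An outcome accurate for `(kk, ξ)` decodes, with residue `kk`. [folklore] -/
theorem decodeUnit_of_mem_Acc {c : ℕ} {kk : ℤ} {ξ : Fin P.T → ℚ} (hc : c ∈ Acc P μ' δ kk ξ) :
    P.decodeUnit c = some (dec P c) ∧ klab P c = kk := by
  obtain ⟨ν, hν, -⟩ := hc
  have hd := dec_eq_of_decodeUnit hν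
  exact ⟨by rw [hν, hd], by rw [klab, hd]⟩

/-- The chosen character of an accurate outcome is a character for which it is accurate, with its residue label. [folklore] -/
theorem xiOf_spec {c : ℕ} (hc : c ∈ AccAll P Λ μ' δ) :
    xiOf P Λ μ' δ c ∈ dualReps P.T Λ ∧ c ∈ Acc P μ' δ (klab P c) (xiOf P Λ μ' δ c) := by
  have hspec := Classical.choose_spec (Classical.choose_spec hc)
  rw [xiOf, dif_pos hc]
  refine ⟨hspec.1, ?_⟩
  rw [(decodeUnit_of_mem_Acc hspec.2).2]
  exact hspec.2

variable [Λ.FiniteIndex] {h : ℕ} [NeZero h]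

/-- **Uniqueness of the character of an accurate outcome**: representatives of distinct characters are `1/h`-separated
(mod 1) in some coordinate while both are within `δ` of the same angles, and `2δ < 1/h`. [folklore] -/
theorem eq_of_mem_Acc (hh : Λ.index = h) (hsep : 2 * δ < 1 / (h : ℝ)) {c : ℕ} {kk kk' : ℤ} {ξ ξ' : Fin P.T → ℚ}
    (hξ : ξ ∈ dualReps P.T Λ) (hξ' : ξ' ∈ dualReps P.T Λ) (hc : c ∈ Acc P μ' δ kk ξ) (hc' : c ∈ Acc P μ' δ kk' ξ') :
    kk = kk' ∧ ξ = ξ' := by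
  obtain ⟨ν, hν, hacc⟩ := hc
  obtain ⟨ν', hν', hacc'⟩ := hc'
  rw [hν] at hν'
  obtain ⟨rfl, rfl⟩ := Prod.mk.inj (Option.some.inj hν')
  refine ⟨rfl, ?_⟩
  by_contra hne
  have hres : resZ h ξ ≠ resZ h ξ' := fun e => hne (by
    rw [← repQ_resZ hh hξ.1 hξ.2, ← repQ_resZ hh hξ'.1 hξ'.2, e])
  obtain ⟨t, ht⟩ := exists_sep_of_ne hres
  rw [repQ_resZ hh hξ.1 hξ.2, repQ_resZ hh hξ'.1 hξ'.2] at ht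
  have h1 := hacc t
  have h2 := hacc' t
  simp only [distZ] at h1 h2
  set x : ℝ := (P.phi ν (t : ℕ) : ℝ) - (kk : ℝ) * μ' t with hx
  have key := ht (round (x - (ξ' t : ℝ)) - round (x - (ξ t : ℝ)))
  have : |((ξ t : ℚ) : ℝ) - ((ξ' t : ℚ) : ℝ) - ((round (x - (ξ' t : ℝ)) - round (x - (ξ t : ℝ)) : ℤ) : ℝ)| ≤ 2 * δ := by
    have e : ((ξ t : ℚ) : ℝ) - ((ξ' t : ℚ) : ℝ) - ((round (x - (ξ' t : ℝ)) - round (x - (ξ t : ℝ)) : ℤ) : ℝ) =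
        (x - (ξ' t : ℝ) - round (x - (ξ' t : ℝ))) - (x - (ξ t : ℝ) - round (x - (ξ t : ℝ))) := by push_cast; ring
    rw [e]
    exact (abs_sub _ _).trans (by linarith)
  linarith

/-- **Labels of an outcome accurate for `(kk, ξ)`**: it is accurate, its residue label is `kk` and its chosen character is
`ξ`. [folklore] -/
theorem labels_of_mem_Acc (hh : Λ.index = h) (hsep : 2 * δ < 1 / (h : ℝ)) {c : ℕ} {kk : ℤ} {ξ : Fin P.T → ℚ}
    (hξ : ξ ∈ dualReps P.T Λ) (hc : c ∈ Acc P μ' δ kk ξ) :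
    c ∈ AccAll P Λ μ' δ ∧ klab P c = kk ∧ xiOf P Λ μ' δ c = ξ := by
  have hacc : c ∈ AccAll P Λ μ' δ := ⟨kk, ξ, hξ, hc⟩
  have hs := xiOf_spec hacc
  obtain ⟨h1, h2⟩ := eq_of_mem_Acc hh hsep hs.1 hξ hs.2 hc
  exact ⟨hacc, h1, h2⟩

variable (P Λ μ' δ)

/-- **The group label** of an outcome: the residue vector `h ξ mod h ∈ annih h Λ` of its character (`0` if inaccurate).
[folklore] -/
def glab (hh : Λ.index = h) (c : ℕ) : annih h Λ :=
  if hc : c ∈ AccAll P Λ μ' δ then ⟨resZ h (xiOf P Λ μ' δ c), resZ_mem_annih hh (xiOf_spec hc).1.2⟩ else 0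

variable {P Λ μ' δ}

/-- The group label of an accurate outcome represents its character. [folklore] -/
theorem glab_of_acc (hh : Λ.index = h) {c : ℕ} (hc : c ∈ AccAll P Λ μ' δ) :
    ((glab P Λ μ' δ hh c : annih h Λ) : Fin P.T → ZMod h) = resZ h (xiOf P Λ μ' δ c) ∧
      repQ h ((glab P Λ μ' δ hh c : annih h Λ) : Fin P.T → ZMod h) = xiOf P Λ μ' δ c := by
  have e : ((glab P Λ μ' δ hh c : annih h Λ) : Fin P.T → ZMod h) = resZ h (xiOf P Λ μ' δ c) := by
    rw [glab, dif_pos hc]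
  exact ⟨e, by rw [e, repQ_resZ hh (xiOf_spec hc).1.1 (xiOf_spec hc).1.2]⟩

/-- **The outcomes accurate for `(kk, repQ g)` are the accurate outcomes labelled `(kk, g)`.** [folklore] -/
theorem mem_Acc_repQ_iff (hh : Λ.index = h) (hsep : 2 * δ < 1 / (h : ℝ)) (kk : ℤ) (g : annih h Λ) (c : ℕ) :
    c ∈ Acc P μ' δ kk (repQ h (g : Fin P.T → ZMod h)) ↔
      c ∈ AccAll P Λ μ' δ ∧ klab P c = kk ∧ glab P Λ μ' δ hh c = g := by
  have hrep : repQ h (g : Fin P.T → ZMod h) ∈ dualReps P.T Λ := ⟨repQ_nonneg_lt _, repQ_pairs_int g.2⟩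
  constructor
  · intro hc
    obtain ⟨hacc, hk, hξ⟩ := labels_of_mem_Acc hh hsep hrep hc
    refine ⟨hacc, hk, Subtype.ext ?_⟩
    rw [(glab_of_acc hh hacc).1, hξ, resZ_repQ]
  · rintro ⟨hacc, rfl, rfl⟩
    rw [(glab_of_acc hh hacc).2]
    exact (xiOf_spec hacc).2

/-- **The outcomes accurate for `kk` and some character are the accurate outcomes labelled `kk`.** [folklore] -/
theorem exists_mem_Acc_iff (hh : Λ.index = h) (hsep : 2 * δ < 1 / (h : ℝ)) (kk : ℤ) (c : ℕ) :
    (∃ ξ' ∈ dualReps P.T Λ, c ∈ Acc P μ' δ kk ξ') ↔ c ∈ AccAll P Λ μ' δ ∧ klab P c = kk := by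
  constructor
  · rintro ⟨ξ', hξ', hc⟩
    obtain ⟨hacc, hk, -⟩ := labels_of_mem_Acc hh hsep hξ' hc
    exact ⟨hacc, hk⟩
  · rintro ⟨hacc, rfl⟩
    exact ⟨_, (xiOf_spec hacc).1, (xiOf_spec hacc).2⟩

/-! ### The combination of a pair and its exact recovery -/

/-- The reduced coefficients as a function of the residues only. [folklore] -/
def cf (kk kk' : ℤ) : ℤ × ℤ := PostParams.coefs (kk, 0) (kk', 0)

omit [Λ.FiniteIndex] [NeZero h] in
/-- `coefs` depends on the residues only. [folklore] -/
theorem coefs_eq_cf (u₁ u₂ : ℤ × ℕ) : PostParams.coefs u₁ u₂ = cf u₁.1 u₂.1 := rfl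

variable (P Λ μ' δ)

/-- **The combined group element of a pair** `c₁ • glab c + c₂ • glab c'`. [cite: Hallgren2005, §4] -/
def sG (hh : Λ.index = h) (c c' : ℕ) : annih h Λ :=
  (cf (klab P c) (klab P c')).1 • glab P Λ μ' δ hh c + (cf (klab P c) (klab P c')).2 • glab P Λ μ' δ hh c'

/-- **The pair event** for a subgroup `H`: both outcomes accurate and the combined group element in `H`. [folklore] -/
def pairEvSet (hh : Λ.index = h) (H : AddSubgroup (annih h Λ)) : Set (ℕ × ℕ) :=
  {p | p.1 ∈ AccAll P Λ μ' δ ∧ p.2 ∈ AccAll P Λ μ' δ ∧ sG P Λ μ' δ hh p.1 p.2 ∈ H}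

variable {P Λ μ' δ}

/-- **Exact recovery for labelled outcomes**: on an accurate pair, `deriveR (dec c) (dec c') t` is the representative of the
combined group element plus an integer. [cite: Hallgren2005, §4; Kitaev1995, §4] -/
theorem exists_deriveR_eq_repQ_sG (hh : Λ.index = h) (hhB : h ≤ P.B) (hδ : 0 ≤ δ)
    (hδK : (4 * (P.K₀ : ℝ) + 2) * δ * (P.B : ℝ) ^ 2 < 1) {c c' : ℕ} (hc : c ∈ AccAll P Λ μ' δ)
    (hc' : c' ∈ AccAll P Λ μ' δ) (t : Fin P.T) :
    ∃ m : ℤ, P.deriveR (dec P c) (dec P c') t = repQ h ((sG P Λ μ' δ hh c c' : annih h Λ) : Fin P.T → ZMod h) t + m := by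
  have h1 : 1 ≤ h := Nat.pos_of_ne_zero (NeZero.ne h)
  obtain ⟨hξ, hacc⟩ := xiOf_spec hc
  obtain ⟨hξ', hacc'⟩ := xiOf_spec hc'
  obtain ⟨hd, -⟩ := decodeUnit_of_mem_Acc hacc
  obtain ⟨hd', -⟩ := decodeUnit_of_mem_Acc hacc'
  obtain ⟨hg, hgq⟩ := glab_of_acc hh hc
  obtain ⟨hg', hgq'⟩ := glab_of_acc hh hc'
  -- accuracy in the form of `exists_deriveR_eq`
  have hang : ∀ {c₀ : ℕ}, c₀ ∈ Acc P μ' δ (klab P c₀) (xiOf P Λ μ' δ c₀) → P.decodeUnit c₀ = some (dec P c₀) →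
      ∀ t : Fin P.T, ∃ m : ℤ, |((P.phi (dec P c₀).2 t : ℚ) : ℝ) - ((dec P c₀).1 : ℝ) * μ' t -
        (xiOf P Λ μ' δ c₀ t : ℝ) - m| ≤ δ := by
    intro c₀ hA hdec t
    obtain ⟨ν, hν, hν'⟩ := hA
    rw [hdec] at hν
    have e : dec P c₀ = (klab P c₀, ν) := Option.some.inj hν
    refine ⟨round (((P.phi ν t : ℚ) : ℝ) - (klab P c₀ : ℝ) * μ' t - (xiOf P Λ μ' δ c₀ t : ℝ)), ?_⟩
    rw [e]
    exact hν' t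
  obtain ⟨m, hm⟩ := exists_deriveR_eq P (u₁ := dec P c) (u₂ := dec P c') h1 hhB hδ hδK
    (fun t => ⟨_, by rw [← hgq, repQ_mul]; rfl⟩) (fun t => ⟨_, by rw [← hgq', repQ_mul]; rfl⟩)
    (abs_le_of_decodeUnit_eq_some P hd) (abs_le_of_decodeUnit_eq_some P hd') (hang hacc hd) (hang hacc' hd') t
  obtain ⟨m', hm'⟩ := exists_repQ_comb_eq (cf (klab P c) (klab P c')).1 (cf (klab P c) (klab P c')).2
    ((glab P Λ μ' δ hh c : annih h Λ) : Fin P.T → ZMod h) ((glab P Λ μ' δ hh c' : annih h Λ) : Fin P.T → ZMod h) t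
  refine ⟨m - m', ?_⟩
  have hco : ((sG P Λ μ' δ hh c c' : annih h Λ) : Fin P.T → ZMod h) =
      (cf (klab P c) (klab P c')).1 • ((glab P Λ μ' δ hh c : annih h Λ) : Fin P.T → ZMod h) +
        (cf (klab P c) (klab P c')).2 • ((glab P Λ μ' δ hh c' : annih h Λ) : Fin P.T → ZMod h) := by
    simp only [sG, AddSubgroup.coe_add, AddSubgroup.coe_zsmul]
  rw [hm, hco, hm', hgq, hgq', coefs_eq_cf, show (dec P c).1 = klab P c from rfl, show (dec P c').1 = klab P c' from rfl]
  push_cast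
  ring


/-- **Exact recovery for labelled outcomes**, uncurried summary form of `exists_deriveR_eq_repQ_sG`.
[cite: Hallgren2005, §4; Kitaev1995, §4] -/
theorem deriveR_eq_repQ_sG_of_accurate : ∀ (P : CubicClassPost.PostParams) (Λ : AddSubgroup (Fin P.T → ℤ))
    [Λ.FiniteIndex] (μ' : Fin P.T → ℝ) (δ : ℝ) (h : ℕ) [NeZero h] (hh : Λ.index = h), h ≤ P.B → 0 ≤ δ →
    (4 * (P.K₀ : ℝ) + 2) * δ * (P.B : ℝ) ^ 2 < 1 → ∀ (c c' : ℕ), c ∈ AccAll P Λ μ' δ → c' ∈ AccAll P Λ μ' δ →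
    ∀ t : Fin P.T, ∃ m : ℤ, P.deriveR (dec P c) (dec P c') t =
      CubicClassPost.repQ h ((sG P Λ μ' δ hh c c' : CubicClassPost.annih h Λ) : Fin P.T → ZMod h) t + m :=
  fun _ _ _ _ _ _ _ hh hhB hδ hδK _ _ hc hc' t => exists_deriveR_eq_repQ_sG hh hhB hδ hδK hc hc' t

end CubicClassSampling

end Literature.Computability.Cryptography

end
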